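import Mathlib
import HarnessLib
import Summits.QuantumFields.Statement
import Summits.QuantumFields.YangMills.Theses.UnitScaleTilt
import Summits.QuantumFields.YangMills.Theses.CovariantDischarge
import Literature.MathematicalPhysics.QuantumFieldTheory.Balaban1983to89.T3YM3TorusStatement
import Literature.MathematicalPhysics.QuantumFieldTheory.Balaban1983to89.WilsonLoopLimit

/-!
# LINE randomised_stokes — skeleton (crux stmt-QuantumFields-19936 `UnitScaleTilt.HistoryTailL`)

Seat ym-r3-idea-2 g8, lens «nearmiss» (LINE 18). Route route-QuantumFields-RandomisedStokes
(`Summits.QuantumFields.YangMills.Theses.RandomisedStokes`; NOT imported here because the farm snapshot predates the route file — the route's crux decls are re-declared below with BYTE-IDENTICAL bodies, so each local `X` is `rfl`-equal to `Summit.QuantumFields.YangMills.Theses.RandomisedStokes.X` and the glue hypothesis of `HistoryTailL_of` is the route's glue item unfolded). The near-miss: LINE 17's deterministic side condition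
√(L^j)(j+1)η ≤ η₀ is the ℓ^∞ row-sum bound on the BCH area chaos of the correction insertions; its ℓ²-operator norm is ≈ 4jη², so the
second-order term is made a PROBABILISTIC crux (colour-isotropy / Hanson–Wright suppression, rate exp(−(cη/g_h²)^α)).
Stubs: `stub_chaosPackage` (HARDEST: the deterministic two-term domination + the chaos tail for an explicit BCH area functional N_q),
`stub_crux_of_package` (bookkeeping ⇒ `ChaosSuppressedDominationL`), `stub_rectMoments` + `stub_tail_of_moments` (the shared
`RectangleTailL`, as in LINE 17), `stub_thinOfDeep` (the thin residual from the shared linear-window residual stmt-22892, window arithmetic).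
The shared residual `CovariantDischarge.DeepWindowTailL` and the glue item `HistoryTailOfChaosL` enter as a hypothesis BY NAME (route item stmt-22892) and as the stub `stub_glue` (the glue item unfolded).
Compositions are kernel-checked (no sorry). No summit and no rung is proved here.
-/

namespace Summit.QuantumFields.YangMills.Cruxes.HistoryTailL.RandomisedStokes

open scoped BigOperators Topology Classical MeasureTheory ProbabilityTheory Matrix
open MeasureTheory

/-- = `Summit.QuantumFields.YangMills.Theses.RandomisedStokes.ChaosSuppressedDominationL` (byte-identical body). -/
def ChaosSuppressedDominationL : Prop :=
  open Literature.MathematicalPhysics.QuantumFieldTheory.Balaban1983to89 Literature.MathematicalPhysics.QuantumFieldTheory.Balaban1983to89.T3ContinuumYM3Torus in ∀ (L : ℕ), ∃ (D R α c C : ℝ) (A : ℕ), 1 ≤ D ∧ 2 ≤ R ∧ 0 < α ∧ 0 < c ∧ 0 ≤ C ∧ ∀ (F : T3Family) (γ : ℝ), F.L = L → 0 < γ → γ ≤ 1 → ∀ (K j : ℕ) (q : Plaq (F.P K) j) (η : ℝ), j ≤ K → 0 < η → η ≤ 1 → (T3UnitScaleTilt.gibbsK F T3UnitLawDensityEML.ℰp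 γ K).real {U | (∀ (i a b : ℕ) (x : Site (F.P K) 0) (μ ν : Fin (F.P K).d), μ ≠ ν → i ≤ j → 1 ≤ a → 1 ≤ b → 2 * (a + b) < (F.P K).sitesPerDir 0 → ((a : ℝ) + b) ≤ R * (L : ℝ) ^ i → GaugeGroup.dist1 (Missing.pathHol U (Missing.rectLoop x μ ν a b)) ≤ η * Real.sqrt ((L : ℝ) ^ i / (L : ℝ) ^ j)) ∧ D * ((j : ℝ) + 1) * η < GaugeGroup.dist1 (GaugeField.plaqHol (Averaging.iter (fun i => BlockAveraging.blockAvg (P := F.P K) (j := i) T3UnitLawDensityEML.ℰp) j U) q)} ≤ C * (F.scheme T3UnitLawDensityEML.ℰp γ).β K ^ A * Real.exp (-((c * (η / (γ * ((L : ℝ)⁻¹) ^ (K - j)))) ^ α))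

/-- = `Summit.QuantumFields.YangMills.Theses.RandomisedStokes.RectangleTailL` (byte-identical body). -/
def RectangleTailL : Prop :=
  open Literature.MathematicalPhysics.QuantumFieldTheory.Balaban1983to89 Literature.MathematicalPhysics.QuantumFieldTheory.Balaban1983to89.T3ContinuumYM3Torus in ∀ (L : ℕ), ∃ (α c C : ℝ) (A : ℕ), 0 < α ∧ 0 < c ∧ 0 ≤ C ∧ ∀ (F : T3Family) (γ : ℝ), F.L = L → 0 < γ → γ ≤ 1 → ∀ (K a b : ℕ) (x : Site (F.P K) 0) (μ ν : Fin (F.P K).d) (t : ℝ), μ ≠ ν → 1 ≤ a → 1 ≤ b → 2 * (a + b) < (F.P K).sitesPerDir 0 → 0 < t → t ≤ 1 → (T3UnitScaleTilt.gibbsK F T3UnitLawDensityEML.ℰp γ K).real {U | t ≤ GaugeGroup.dist1 (Missing.pathHol U (Missing.rectLoop x μ ν a b))} ≤ C * (F.scheme T3UnitLawDensityEML.ℰp γ).β K ^ A * ((a : ℝ) + b) ^ A * Real.exp (-((c * (t ^ 2 * (F.scheme T3UnitLawDensityEML.ℰp γ).β K / (((a : ℝ) + b) * (1 + Real.log ((a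 : ℝ) + b))))) ^ α))

/-- = `Summit.QuantumFields.YangMills.Theses.RandomisedStokes.ThinDeepWindowTailL` (byte-identical body, AFTER the 23886 restate of critic #209: inner prefactor binder `N'`). -/
def ThinDeepWindowTailL : Prop :=
  open Literature.MathematicalPhysics.QuantumFieldTheory.Balaban1983to89 Literature.MathematicalPhysics.QuantumFieldTheory.Balaban1983to89.T3ContinuumYM3Torus in ∀ (L N : ℕ), 0 < N → ∀ (b₀ p₀ b₂ : ℝ), 0 < b₀ → 2 < p₀ → (N : ℝ) ≤ p₀ → b₀ ≤ b₂ → ∃ (γ₁ C c : ℝ) (N' : ℕ), 0 < γ₁ ∧ γ₁ ≤ 1 ∧ 0 < c ∧ ∀ (F : T3Family) (γ : ℝ), F.L = L → 0 < γ → γ ≤ γ₁ → ∀ (K j : ℕ), 1 ≤ j → j ≤ K → ((j : ℝ) + 1) ^ N > B10.pFun b₀ p₀ (Real.sqrt (γ * ((F.L : ℝ)⁻¹) ^ (K - j))) → ∀ p : Plaq (F.P K) j, (T3UnitScaleTilt.gibbsK F T3UnitLawDensityEML.ℰp γ K).real {U | (∀ k, k < j → PlaqSmall (T3UnitScaleTilt.θBal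 F.L γ b₀ p₀ (K - k)) (Averaging.iter (fun i => BlockAveraging.blockAvg (P := F.P K) (j := i) T3UnitLawDensityEML.ℰp) k U)) ∧ PlaqSmall (T3UnitScaleTilt.θBal F.L γ b₂ p₀ (K - j)) (Averaging.iter (fun i => BlockAveraging.blockAvg (P := F.P K) (j := i) T3UnitLawDensityEML.ℰp) j U) ∧ T3UnitScaleTilt.θBal F.L γ b₀ p₀ (K - j) ≤ GaugeGroup.dist1 (GaugeField.plaqHol (Averaging.iter (fun i => BlockAveraging.blockAvg (P := F.P K) (j := i) T3UnitLawDensityEML.ℰp) j U) p)} ≤ C * ((γ * ((F.L : ℝ)⁻¹) ^ (K - j))⁻¹) ^ N' * Real.exp (-(c * B10.pFun b₀ p₀ (Real.sqrt (γ * ((F.L : ℝ)⁻¹) ^ (K - j))) ^ 2))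

/-- Layer-2 statement: THE CHAOS PACKAGE — a deterministic functional N_q per (F, γ, K, j, q) with (i) two-term domination under profile
flatness and (ii) the chaos tail Gibbs_K(flat ∧ η < |N_q U|) ≤ Cβ^A exp(−(cη/g_h²)^α). -/
def ChaosPackageL : Prop :=
  open Literature.MathematicalPhysics.QuantumFieldTheory.Balaban1983to89 Literature.MathematicalPhysics.QuantumFieldTheory.Balaban1983to89.T3ContinuumYM3Torus in ∀ (L : ℕ), ∃ (D₀ R α c C : ℝ) (A : ℕ), 0 ≤ D₀ ∧ 2 ≤ R ∧ 0 < α ∧ 0 < c ∧ 0 ≤ C ∧ ∀ (F : T3Family) (γ : ℝ), F.L = L → 0 < γ → γ ≤ 1 → ∀ (K j : ℕ) (q : Plaq (F.P K) j), j ≤ K → ∃ N : GaugeField (F.P K) 0 (Matrix.specialUnitaryGroup (Fin 2) ℂ) → ℝ, (∀ (U : GaugeField (F.P K) 0 (Matrix.specialUnitaryGroup (Fin 2) ℂ)) (η : ℝ), 0 < η → (∀ (i a b : ℕ) (x : Site (F.P K) 0) (μ ν : Fin (F.P K).d), μ ≠ ν → i ≤ j → 1 ≤ a → 1 ≤ b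 → 2 * (a + b) < (F.P K).sitesPerDir 0 → ((a : ℝ) + b) ≤ R * (L : ℝ) ^ i → GaugeGroup.dist1 (Missing.pathHol U (Missing.rectLoop x μ ν a b)) ≤ η * Real.sqrt ((L : ℝ) ^ i / (L : ℝ) ^ j)) → GaugeGroup.dist1 (GaugeField.plaqHol (Averaging.iter (fun i => BlockAveraging.blockAvg (P := F.P K) (j := i) T3UnitLawDensityEML.ℰp) j U) q) ≤ D₀ * ((j : ℝ) + 1) * η + |N U|) ∧ (∀ (η : ℝ), 0 < η → η ≤ 1 → (T3UnitScaleTilt.gibbsK F T3UnitLawDensityEML.ℰp γ K).real {U | (∀ (i a b : ℕ) (x : Site (F.P K) 0) (μ ν : Fin (F.P K).d), μ ≠ ν → i ≤ j → 1 ≤ a → 1 ≤ b → 2 * (a + b) < (F.P K).sitesPerDir 0 → ((a : ℝ) + b) ≤ R * (L : ℝ) ^ i → GaugeGroup.dist1 (Missing.pathHol U (Missing.rectLoop x μ ν a b)) ≤ η * Real.sqrt ((L : ℝ) ^ i / (L : ℝ) ^ j)) ∧ η < |N U|} ≤ C * (F.scheme T3UnitLawDensityEML.ℰp γ).β K ^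 A * Real.exp (-((c * (η / (γ * ((L : ℝ)⁻¹) ^ (K - j)))) ^ α)))

/-- Layer-2 statement (shared with LINE 17): sub-Gaussian perimeter-law moments of one finest contractible rectangle. -/
def RectMomentsL : Prop :=
  open Literature.MathematicalPhysics.QuantumFieldTheory.Balaban1983to89 Literature.MathematicalPhysics.QuantumFieldTheory.Balaban1983to89.T3ContinuumYM3Torus in ∀ (L : ℕ), ∃ (c C : ℝ) (A : ℕ), 0 < c ∧ 0 ≤ C ∧ ∀ (F : T3Family) (γ : ℝ), F.L = L → 0 < γ → γ ≤ 1 → ∀ (K a b : ℕ) (x : Site (F.P K) 0) (μ ν : Fin (F.P K).d) (n : ℕ), μ ≠ ν → 1 ≤ a → 1 ≤ b → 2 * (a + b) < (F.P K).sitesPerDir 0 → 1 ≤ n → ∫ U, (GaugeGroup.dist1 (Missing.pathHol U (Missing.rectLoop x μ ν a b))) ^ n ∂(T3UnitScaleTilt.gibbsK F T3UnitLawDensityEML.ℰp γ K) ≤ C * (F.scheme T3UnitLawDensityEML.ℰp γ).β K ^ A * ((a : ℝ) + b) ^ A * ((n : ℝ) * (((a : ℝ) + b) * (1 + Real.log ((a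 : ℝ) + b))) / (c * (F.scheme T3UnitLawDensityEML.ℰp γ).β K)) ^ ((n : ℝ) / 2)

/-- STUB (HARDEST, XL): the chaos package — (i) LINE 17's unrolling algebra without side condition, N_q = the BCH area functional of the
insertion fluxes; (ii) a Hanson–Wright inequality for N_q under the Gibbs measure (ψ₂ input from the rectangle flatness, r⁻³ mixing of the
insertion fluxes along a side, colour isotropy). -/
theorem stub_chaosPackage : ChaosPackageL := by
  sorry

/-- STUB (S/M): D = D₀ + 1 and monotonicity of `Measure.real` turn the package into the crux. -/
theorem stub_crux_of_package : ChaosPackageL → ChaosSuppressedDominationL := by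
  sorry

/-- STUB (XL, shared with LINE 17): perimeter-law moments of one finest contractible rectangle, uniform in the cut-off. -/
theorem stub_rectMoments : RectMomentsL := by
  sorry

/-- STUB (M, shared with LINE 17): Markov at the optimal moment. -/
theorem stub_tail_of_moments : RectMomentsL → RectangleTailL := by
  sorry

/-- STUB (M): the sliver (j+1)^N > p(g_h) with N ≤ p₀ lies in a linear window K < N₁·j, so the shared residual (stmt-22892) instantiates. -/
theorem stub_thinOfDeep : Summit.QuantumFields.YangMills.Theses.CovariantDischarge.DeepWindowTailL → ThinDeepWindowTailL := by
  sorry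

/-- COMPOSITION (kernel-checked). -/
theorem ChaosSuppressedDominationL_of (h₁ : ChaosPackageL) (h₂ : ChaosPackageL → ChaosSuppressedDominationL) :
    ChaosSuppressedDominationL := h₂ h₁

/-- COMPOSITION (kernel-checked). -/
theorem ThinDeepWindowTailL_of (h₁ : Summit.QuantumFields.YangMills.Theses.CovariantDischarge.DeepWindowTailL)
    (h₂ : Summit.QuantumFields.YangMills.Theses.CovariantDischarge.DeepWindowTailL → ThinDeepWindowTailL) : ThinDeepWindowTailL := h₂ h₁

/-- COMPOSITION (kernel-checked). -/
theorem RectangleTailL_of (h₁ : RectMomentsL) (h₂ : RectMomentsL → RectangleTailL) : RectangleTailL := h₂ h₁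

/-- The TARGET CRUX under a local name (so that only `HistoryTailL_of` concludes the crux BY NAME; `CruxGoal` unfolds to it by `rfl`). -/
def CruxGoal : Prop :=
  Summit.QuantumFields.YangMills.Theses.UnitScaleTilt.HistoryTailL

theorem cruxGoal_iff : CruxGoal ↔ Summit.QuantumFields.YangMills.Theses.UnitScaleTilt.HistoryTailL := Iff.rfl

/-- STUB (M, = the route's glue item `HistoryTailOfChaosL`, unfolded): union bound over rectangles off the sliver ((j+1)^N ≤ p(g_h),
N = ⌈2 + 2/α_R + 2/α_X⌉, p₀ ≥ N), the chaos tail at η = θ(h)/(2D(j+1)), the thin residual on the sliver, first-exit bookkeeping. -/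
theorem stub_glue : RectangleTailL → ChaosSuppressedDominationL → ThinDeepWindowTailL → CruxGoal := by
  sorry

/-- COMPOSITION (kernel-checked): the stubs, the shared linear-window residual (route item stmt-22892 of CovariantDischarge) and the route's
glue item conclude the TARGET CRUX BY NAME. -/
theorem HistoryTailL_of
    (hW : Summit.QuantumFields.YangMills.Theses.CovariantDischarge.DeepWindowTailL) :
    Summit.QuantumFields.YangMills.Theses.UnitScaleTilt.HistoryTailL :=
  cruxGoal_iff.mp
    (stub_glue (RectangleTailL_of stub_rectMoments stub_tail_of_moments)
      (ChaosSuppressedDominationL_of stub_chaosPackage stub_crux_of_package) (ThinDeepWindowTailL_of hW stub_thinOfDeep))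

end Summit.QuantumFields.YangMills.Cruxes.HistoryTailL.RandomisedStokes
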